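import Mathlib
import HarnessLib
import Summits.ABC.ABC.Theses.CongruentialReceptacle

/-!
# Crux `CompactBalanceTransfer` (stmt-ABC-1725), line `birth` — what the Frey–Szpiro hypothesis `F` buys

Support file (`--supports stmt-ABC-1725`) of the line lead `prover-line-stmt-ABC-1725-c2-0` (2026-08-17) for the
registered skeleton `Cruxes/CompactBalanceTransfer/Lines/birth.lean` (stubs `stub_balancedToFreySzpiro : H → F` and
`stub_freySzpiroPowerDeep : F → ∀ δ > 0, abc on the power-deep cell`). It lands under `Theorems/` — importable, unlike the
`Cruxes/` workfiles — the sorry-free infrastructure around the second stub, written by the crux-strategist p1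
(`Cruxes/CompactBalanceTransfer/StrategySplitP1.lean` §2–§3, seat `planner-cstrat-stmt-ABC-1725-p1-0`) and the
skeleton-register seat (`Lines/birth.lean`, `planner-skel-stmt-ABC-1725-0`), with proofs adapted verbatim:

* `abc_threeHalves_of_freySzpiro` — `F` ALONE gives abc with exponent `3/2 + ε` (the classical free bound,
  `(abc)² ≥ c⁴/4`); recorded so that no worker on stub 2 mistakes it for progress.
* `abc_of_freySzpiro_of_powerDeep` — `F` together with abc on every power-deep cell
  `{log min(a,b) ≤ (1−δ)·log c}` gives `ABC`: off the cell `(abc)² > c^(6−2δ)/4`, so `F` at `ε` with `δ := ε/(1+ε)`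
  already yields exponent `(6+ε)(1+ε)/(6+4ε) ≤ 1+ε`. This is the composition step of the skeleton (there
  `Birth.abc_of_freySzpiro_of_powerDeep`), now importable; its curried form is the registered (and hereby PROVED)
  glue stub `stub_freySzpiroPaysComplement` of the line, so that the skeleton keeps exactly the two OPEN stubs.
* `freySzpiroToABC_iff_powerDeep` — hence the registered signature of `stub_freySzpiroPowerDeep` is EQUIVALENT to
  Oesterlé's open implication `F → ABC` (child 2 of the currency split D1,
  `Theorems/CongruentialReceptacleCompactBalanceTransferSplit.lean`): the stub is a genuine restatement of child 2 on
  its residual regime, neither weaker nor stronger.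

Here `F := ∀ ε > 0, ∃ C, ∀ abc-triples, (abc)² ≤ C·rad(abc)^(6+ε)` (Szpiro `6+ε` for the Frey curves of ALL
abc-triples in the route's elementary currency `2⁸Δ_min = (abc)²`, `N = rad(abc)`). All hypotheses are spelled out
(no `def`s); unconditional; standard axioms; no named facts.
-/

-- `Summit.<Summit>.<Problem>`: for the single-conjunct summit `ABC` the duplicate `ABC.ABC` is mandated.
set_option linter.dupNamespace false

namespace Summit.ABC.ABC.Theorems.CompactBalanceTransfer.PowerDeep

open Literature.NumberTheory.DiophantineGeometry
open Summit.ABC.ABC.Theses.CongruentialReceptacle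

/-! ## Elementary facts about abc triples -/

/-- For an abc triple, `c ≤ 2ab` (the larger of `a, b` is `≥ c/2` and the other is `≥ 1`). [folklore] -/
theorem le_two_mul_ab_of_isABCTriple {a b c : ℕ} (h : IsABCTriple a b c) : c ≤ 2 * (a * b) := by
  obtain ⟨ha, hb, hsum, _⟩ := h
  subst hsum
  nlinarith

/-- The radical `rad a b c` (computed in `ℕ`) is positive. [folklore] -/
theorem rad_pos_nat (a b c : ℕ) : 0 < rad a b c := by
  rw [rad_def]; exact Nat.pos_of_ne_zero UniqueFactorizationMonoid.radical_ne_zero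

/-! ## `F` alone: exponent `3/2` -/

/-- **`F` gives abc with exponent `3/2 + ε`.** From `(abc)² ≤ C·rad^(6+4ε)` and `abc ≥ c·(c/2)`:
`c⁴/4 ≤ C·rad^(6+4ε)`, so `c ≤ (4C)^(1/4)·rad^(3/2+ε)`. (Oesterlé 1988 §3: Szpiro's exponent `6+ε` for the Frey
curves yields abc with exponent `3/2`; proof adapted verbatim from `StrategySplitP1.abc_threeHalves_of_freySzpiro`.)
[folklore] -/
theorem abc_threeHalves_of_freySzpiro
    (hF : ∀ ε : ℝ, 0 < ε → ∃ C : ℝ, ∀ a b c : ℕ, IsABCTriple a b c →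
      ((a * b * c : ℕ) : ℝ) ^ 2 ≤ C * ((rad a b c : ℕ) : ℝ) ^ (6 + ε)) :
    ∀ ε : ℝ, 0 < ε → ∃ C : ℝ, 0 < C ∧ ∀ a b c : ℕ, IsABCTriple a b c →
      (c : ℝ) < C * ((rad a b c : ℕ) : ℝ) ^ (3 / 2 + ε) := by
  intro ε hε
  obtain ⟨CF, hCF⟩ := hF (4 * ε) (by positivity)
  set CF' : ℝ := max CF 1 with hCF'def
  have hCF'1 : (1 : ℝ) ≤ CF' := le_max_right _ _
  have hCF'pos : (0 : ℝ) < CF' := lt_of_lt_of_le one_pos hCF'1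
  set K : ℝ := (Real.log CF' + 2 * Real.log 2) / 4 + 1 with hKdef
  refine ⟨Real.exp K, Real.exp_pos K, fun a b c habc => ?_⟩
  have hF0 := hCF a b c habc
  have hab2 := le_two_mul_ab_of_isABCTriple habc
  obtain ⟨ha0, hb0, hsum, _⟩ := habc
  have hcpos : (0 : ℝ) < c := by exact_mod_cast (show 0 < c by omega)
  have hapos : (0 : ℝ) < a := by exact_mod_cast ha0
  have hbpos : (0 : ℝ) < b := by exact_mod_cast hb0
  have hRpos : (0 : ℝ) < ((rad a b c : ℕ) : ℝ) := by exact_mod_cast rad_pos_nat a b c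
  have hR1 : (1 : ℝ) ≤ ((rad a b c : ℕ) : ℝ) := by exact_mod_cast rad_pos_nat a b c
  have hlogR : 0 ≤ Real.log ((rad a b c : ℕ) : ℝ) := Real.log_nonneg hR1
  have habcpos : (0 : ℝ) < ((a * b * c : ℕ) : ℝ) := by push_cast; positivity
  -- F in logarithms
  have hXnn : (0 : ℝ) ≤ ((rad a b c : ℕ) : ℝ) ^ (6 + 4 * ε) := Real.rpow_nonneg hRpos.le _
  have hXpos : (0 : ℝ) < ((rad a b c : ℕ) : ℝ) ^ (6 + 4 * ε) := Real.rpow_pos_of_pos hRpos _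
  have hF1 : ((a * b * c : ℕ) : ℝ) ^ 2 ≤ CF' * ((rad a b c : ℕ) : ℝ) ^ (6 + 4 * ε) :=
    le_trans hF0 (mul_le_mul_of_nonneg_right (le_max_left _ _) hXnn)
  have hlogF : 2 * Real.log ((a * b * c : ℕ) : ℝ) ≤
      Real.log CF' + (6 + 4 * ε) * Real.log ((rad a b c : ℕ) : ℝ) := by
    have h := Real.log_le_log (by positivity) hF1
    have e2 : Real.log (((a * b * c : ℕ) : ℝ) ^ 2) = 2 * Real.log ((a * b * c : ℕ) : ℝ) := by
      rw [Real.log_pow]; norm_num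
    rw [e2, Real.log_mul hCF'pos.ne' hXpos.ne', Real.log_rpow hRpos] at h
    linarith
  -- lower bound: log(abc) ≥ 2 log c − log 2
  have hlow : 2 * Real.log c - Real.log 2 ≤ Real.log ((a * b * c : ℕ) : ℝ) := by
    have hab2' : (c : ℝ) ≤ 2 * ((a : ℝ) * b) := by exact_mod_cast hab2
    have e : Real.log ((a * b * c : ℕ) : ℝ) = Real.log ((a : ℝ) * b) + Real.log c := by
      push_cast
      rw [Real.log_mul (by positivity) hcpos.ne']
    have h1 : Real.log c ≤ Real.log 2 + Real.log ((a : ℝ) * b) := by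
      have := Real.log_le_log hcpos hab2'
      rwa [Real.log_mul (by norm_num) (by positivity)] at this
    rw [e]; linarith
  -- combine: 4 log c − 2 log 2 ≤ log CF' + (6+4ε) log rad
  have hlogc : Real.log c < K + (3 / 2 + ε) * Real.log ((rad a b c : ℕ) : ℝ) := by
    have : 4 * Real.log c ≤
        Real.log CF' + 2 * Real.log 2 + (6 + 4 * ε) * Real.log ((rad a b c : ℕ) : ℝ) := by
      linarith
    rw [hKdef]
    nlinarith
  calc (c : ℝ) = Real.exp (Real.log c) := (Real.exp_log hcpos).symm
    _ < Real.exp (K + (3 / 2 + ε) * Real.log ((rad a b c : ℕ) : ℝ)) := Real.exp_lt_exp.mpr hlogc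
    _ = Real.exp K * ((rad a b c : ℕ) : ℝ) ^ (3 / 2 + ε) := by
        rw [Real.exp_add, Real.rpow_def_of_pos hRpos, mul_comm (Real.log _) (3 / 2 + ε)]

/-! ## `F` pays off the complement of the power-deep cells -/

/-- **`F` plus abc on every power-deep cell gives abc** (census D5; the composition step of line `birth`).
For `ε > 0` put `δ := ε/(1+ε)`. Deep triples (`log min ≤ (1−δ) log c`) are covered by the power-deep hypothesis at
`ε`; off the cell, `log(abc) > (3−δ)·log c − log 2` (the large member is `≥ c/2`) and `F` at `ε` give
`(6−2δ)·log c < log C + 2 log 2 + (6+ε)·log rad`, and `6 − 2δ = (6+4ε)/(1+ε)`, `(6+ε)/(6+4ε) ≤ 1`.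
(Proof adapted verbatim from `Lines/birth.lean` / `StrategySplitP1.lean`.) [folklore] -/
theorem abc_of_freySzpiro_of_powerDeep
    (hF : ∀ ε : ℝ, 0 < ε → ∃ C : ℝ, ∀ a b c : ℕ, IsABCTriple a b c →
      ((a * b * c : ℕ) : ℝ) ^ 2 ≤ C * ((rad a b c : ℕ) : ℝ) ^ (6 + ε))
    (hD : ∀ δ : ℝ, 0 < δ → ∀ ε : ℝ, 0 < ε → ∃ C : ℝ, ∀ a b c : ℕ, IsABCTriple a b c →
      Real.log ((min a b : ℕ) : ℝ) ≤ (1 - δ) * Real.log (c : ℝ) →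
        (c : ℝ) < C * ((rad a b c : ℕ) : ℝ) ^ (1 + ε)) :
    _root_.ABC := by
  rw [_root_.ABC_iff]
  intro ε hε
  have h1ε : (0 : ℝ) < 1 + ε := by positivity
  have h64 : (0 : ℝ) < 6 + 4 * ε := by positivity
  set δ : ℝ := ε / (1 + ε) with hδdef
  have hδpos : 0 < δ := by rw [hδdef]; positivity
  have h62δ : 6 - 2 * δ = (6 + 4 * ε) / (1 + ε) := by
    rw [hδdef]; field_simp; ring
  obtain ⟨CD, hCD⟩ := hD δ hδpos ε hε
  obtain ⟨CF, hCF⟩ := hF ε hε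
  set CF' : ℝ := max CF 1 with hCF'def
  have hCF'1 : (1 : ℝ) ≤ CF' := le_max_right _ _
  have hCF'pos : (0 : ℝ) < CF' := lt_of_lt_of_le one_pos hCF'1
  set K : ℝ := (1 + ε) / (6 + 4 * ε) * (Real.log CF' + 2 * Real.log 2) with hKdef
  refine ⟨max CD (Real.exp K), lt_max_of_lt_right (Real.exp_pos K), fun a b c habc => ?_⟩
  have hRpos : (0 : ℝ) < ((rad a b c : ℕ) : ℝ) := by exact_mod_cast rad_pos_nat a b c
  have hR1 : (1 : ℝ) ≤ ((rad a b c : ℕ) : ℝ) := by exact_mod_cast rad_pos_nat a b c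
  have hlogR : 0 ≤ Real.log ((rad a b c : ℕ) : ℝ) := Real.log_nonneg hR1
  have hX1 : (0 : ℝ) ≤ ((rad a b c : ℕ) : ℝ) ^ (1 + ε) := Real.rpow_nonneg hRpos.le _
  by_cases hdeep : Real.log ((min a b : ℕ) : ℝ) ≤ (1 - δ) * Real.log (c : ℝ)
  · -- deep: covered by the power-deep cell hypothesis
    calc (c : ℝ) < CD * ((rad a b c : ℕ) : ℝ) ^ (1 + ε) := hCD a b c habc hdeep
      _ ≤ max CD (Real.exp K) * ((rad a b c : ℕ) : ℝ) ^ (1 + ε) :=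
          mul_le_mul_of_nonneg_right (le_max_left _ _) hX1
  · -- off the cell: F pays
    push Not at hdeep
    have hF0 := hCF a b c habc
    obtain ⟨ha0, hb0, hsum, _⟩ := habc
    have hcpos : (0 : ℝ) < c := by exact_mod_cast (show 0 < c by omega)
    have hapos : (0 : ℝ) < a := by exact_mod_cast ha0
    have hbpos : (0 : ℝ) < b := by exact_mod_cast hb0
    have habcpos : (0 : ℝ) < ((a * b * c : ℕ) : ℝ) := by push_cast; positivity
    have hXnn : (0 : ℝ) ≤ ((rad a b c : ℕ) : ℝ) ^ (6 + ε) := Real.rpow_nonneg hRpos.le _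
    have hXpos : (0 : ℝ) < ((rad a b c : ℕ) : ℝ) ^ (6 + ε) := Real.rpow_pos_of_pos hRpos _
    have hF1 : ((a * b * c : ℕ) : ℝ) ^ 2 ≤ CF' * ((rad a b c : ℕ) : ℝ) ^ (6 + ε) :=
      le_trans hF0 (mul_le_mul_of_nonneg_right (le_max_left _ _) hXnn)
    have hlogF : 2 * Real.log ((a * b * c : ℕ) : ℝ) ≤
        Real.log CF' + (6 + ε) * Real.log ((rad a b c : ℕ) : ℝ) := by
      have h := Real.log_le_log (by positivity) hF1
      have e2 : Real.log (((a * b * c : ℕ) : ℝ) ^ 2) = 2 * Real.log ((a * b * c : ℕ) : ℝ) := by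
        rw [Real.log_pow]; norm_num
      rw [e2, Real.log_mul hCF'pos.ne' hXpos.ne', Real.log_rpow hRpos] at h
      linarith
    -- lower bound: log(abc) > (3 − δ) log c − log 2
    have e : Real.log ((a * b * c : ℕ) : ℝ) = Real.log a + Real.log b + Real.log c := by
      push_cast
      rw [Real.log_mul (by positivity) hcpos.ne', Real.log_mul hapos.ne' hbpos.ne']
    have hlow : (3 - δ) * Real.log c - Real.log 2 < Real.log ((a * b * c : ℕ) : ℝ) := by
      rcases le_total a b with hab | hab
      · have hmin : ((min a b : ℕ) : ℝ) = (a : ℝ) := by rw [min_eq_left hab]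
        rw [hmin] at hdeep
        have hb2 : (c : ℝ) ≤ 2 * (b : ℝ) := by exact_mod_cast (show c ≤ 2 * b by omega)
        have hlogb : Real.log c ≤ Real.log 2 + Real.log b := by
          have := Real.log_le_log hcpos hb2
          rwa [Real.log_mul (by norm_num) hbpos.ne'] at this
        rw [e]; linarith
      · have hmin : ((min a b : ℕ) : ℝ) = (b : ℝ) := by rw [min_eq_right hab]
        rw [hmin] at hdeep
        have ha2 : (c : ℝ) ≤ 2 * (a : ℝ) := by exact_mod_cast (show c ≤ 2 * a by omega)
        have hloga : Real.log c ≤ Real.log 2 + Real.log a := by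
          have := Real.log_le_log hcpos ha2
          rwa [Real.log_mul (by norm_num) hapos.ne'] at this
        rw [e]; linarith
    -- combine
    have hcomb : (6 + 4 * ε) / (1 + ε) * Real.log c <
        Real.log CF' + 2 * Real.log 2 + (6 + ε) * Real.log ((rad a b c : ℕ) : ℝ) := by
      rw [← h62δ]; linarith
    have hlogc : Real.log c < K + (1 + ε) * Real.log ((rad a b c : ℕ) : ℝ) := by
      have hmul := mul_lt_mul_of_pos_left hcomb (div_pos h1ε h64)
      have e1 : (1 + ε) / (6 + 4 * ε) * ((6 + 4 * ε) / (1 + ε) * Real.log c) = Real.log c := by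
        field_simp
      have e2 : (1 + ε) / (6 + 4 * ε) *
          (Real.log CF' + 2 * Real.log 2 + (6 + ε) * Real.log ((rad a b c : ℕ) : ℝ)) =
          K + (1 + ε) * ((6 + ε) / (6 + 4 * ε)) * Real.log ((rad a b c : ℕ) : ℝ) := by
        rw [hKdef]; field_simp
      rw [e1, e2] at hmul
      have hfrac : (6 + ε) / (6 + 4 * ε) ≤ 1 := by
        rw [div_le_one h64]; linarith
      have hle : (1 + ε) * ((6 + ε) / (6 + 4 * ε)) * Real.log ((rad a b c : ℕ) : ℝ) ≤
          (1 + ε) * Real.log ((rad a b c : ℕ) : ℝ) := by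
        have h1 : (1 + ε) * ((6 + ε) / (6 + 4 * ε)) ≤ (1 + ε) * 1 :=
          mul_le_mul_of_nonneg_left hfrac h1ε.le
        have h2 := mul_le_mul_of_nonneg_right h1 hlogR
        simpa using h2
      linarith
    calc (c : ℝ) = Real.exp (Real.log c) := (Real.exp_log hcpos).symm
      _ < Real.exp (K + (1 + ε) * Real.log ((rad a b c : ℕ) : ℝ)) := Real.exp_lt_exp.mpr hlogc
      _ = Real.exp K * ((rad a b c : ℕ) : ℝ) ^ (1 + ε) := by
          rw [Real.exp_add, Real.rpow_def_of_pos hRpos, mul_comm (Real.log _) (1 + ε)]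
      _ ≤ max CD (Real.exp K) * ((rad a b c : ℕ) : ℝ) ^ (1 + ε) :=
          mul_le_mul_of_nonneg_right (le_max_right _ _) hX1

/-- **Registered stub `stub_freySzpiroPaysComplement` of line `birth` (crux stmt-ABC-1725) — the composition
glue, PROVED.** `F →` (abc on every power-deep cell, every `δ > 0`) `→ ABC`: verbatim the registered signature;
the proof is `abc_of_freySzpiro_of_powerDeep`. With this landed, the skeleton's `CompactBalanceTransfer_of` is
`fun hH => stub_freySzpiroPaysComplement (stub₁ hH) (stub₂ (stub₁ hH))` over the two OPEN stubs. [folklore] -/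
theorem stub_freySzpiroPaysComplement : (∀ ε : ℝ, 0 < ε → ∃ C : ℝ, ∀ a b c : ℕ, IsABCTriple a b c → ((a * b * c : ℕ) : ℝ) ^ 2 ≤ C * ((rad a b c : ℕ) : ℝ) ^ (6 + ε)) → (∀ δ : ℝ, 0 < δ → ∀ ε : ℝ, 0 < ε → ∃ C : ℝ, ∀ a b c : ℕ, IsABCTriple a b c → Real.log ((min a b : ℕ) : ℝ) ≤ (1 - δ) * Real.log (c : ℝ) → (c : ℝ) < C * ((rad a b c : ℕ) : ℝ) ^ (1 + ε)) → _root_.ABC :=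
  fun hF hD => abc_of_freySzpiro_of_powerDeep hF hD

/-- `ABC` restricts to every power-deep cell (trivially: drop the cell hypothesis). [folklore] -/
theorem powerDeep_of_abc (h : _root_.ABC) :
    ∀ δ : ℝ, 0 < δ → ∀ ε : ℝ, 0 < ε → ∃ C : ℝ, ∀ a b c : ℕ, IsABCTriple a b c →
      Real.log ((min a b : ℕ) : ℝ) ≤ (1 - δ) * Real.log (c : ℝ) →
        (c : ℝ) < C * ((rad a b c : ℕ) : ℝ) ^ (1 + ε) := by
  intro δ _ ε hε
  obtain ⟨C, _, hC⟩ := (_root_.ABC_iff.mp h) ε hε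
  exact ⟨C, fun a b c habc _ => hC a b c habc⟩

/-- **Stub 2 of line `birth` is exactly Oesterlé's implication (census D5).** `F → ABC` (child 2 of the
currency split D1, `compactBalanceTransfer_iff_subs`) is EQUIVALENT to the registered signature of
`stub_freySzpiroPowerDeep`, namely `F →` abc on every power-deep cell `{log min(a,b) ≤ (1−δ)·log c}`: `→` restricts
`ABC` to the cells, `←` is `abc_of_freySzpiro_of_powerDeep` (`F` pays for the complement). So the stub is neither a
weakening nor a strengthening of child 2, and is irrefutable short of `¬ABC`. [folklore] -/
theorem freySzpiroToABC_iff_powerDeep :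
    ((∀ ε : ℝ, 0 < ε → ∃ C : ℝ, ∀ a b c : ℕ, IsABCTriple a b c →
        ((a * b * c : ℕ) : ℝ) ^ 2 ≤ C * ((rad a b c : ℕ) : ℝ) ^ (6 + ε)) → _root_.ABC) ↔
    ((∀ ε : ℝ, 0 < ε → ∃ C : ℝ, ∀ a b c : ℕ, IsABCTriple a b c →
        ((a * b * c : ℕ) : ℝ) ^ 2 ≤ C * ((rad a b c : ℕ) : ℝ) ^ (6 + ε)) →
      ∀ δ : ℝ, 0 < δ → ∀ ε : ℝ, 0 < ε → ∃ C : ℝ, ∀ a b c : ℕ, IsABCTriple a b c →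
        Real.log ((min a b : ℕ) : ℝ) ≤ (1 - δ) * Real.log (c : ℝ) →
          (c : ℝ) < C * ((rad a b c : ℕ) : ℝ) ^ (1 + ε)) :=
  ⟨fun h hF => powerDeep_of_abc (h hF),
   fun h hF => abc_of_freySzpiro_of_powerDeep hF (h hF)⟩

/-- **The crux from the two stub statements of line `birth`, through importable glue.** If balanced abc gives
`F` (stub 1) and `F` gives abc on every power-deep cell (stub 2), then `CompactBalanceTransfer`: the landed D1 glue
`compactBalanceTransfer_of_subs` shape with child 2 in power-deep form. This is the skeleton's composition
`Birth.abc_of_stubSigs`, made importable for the final assembly. [folklore] -/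
theorem compactBalanceTransfer_of_stubs
    (h₁ : (∀ κ : ℝ, 0 < κ → ∀ ε : ℝ, 0 < ε → ∃ C : ℝ, ∀ a b c : ℕ, IsABCTriple a b c →
          κ * (c : ℝ) ≤ (a : ℝ) → κ * (c : ℝ) ≤ (b : ℝ) →
            (c : ℝ) < C * ((rad a b c : ℕ) : ℝ) ^ (1 + ε)) →
        ∀ ε : ℝ, 0 < ε → ∃ C : ℝ, ∀ a b c : ℕ, IsABCTriple a b c →
          ((a * b * c : ℕ) : ℝ) ^ 2 ≤ C * ((rad a b c : ℕ) : ℝ) ^ (6 + ε))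
    (h₂ : (∀ ε : ℝ, 0 < ε → ∃ C : ℝ, ∀ a b c : ℕ, IsABCTriple a b c →
          ((a * b * c : ℕ) : ℝ) ^ 2 ≤ C * ((rad a b c : ℕ) : ℝ) ^ (6 + ε)) →
        ∀ δ : ℝ, 0 < δ → ∀ ε : ℝ, 0 < ε → ∃ C : ℝ, ∀ a b c : ℕ, IsABCTriple a b c →
          Real.log ((min a b : ℕ) : ℝ) ≤ (1 - δ) * Real.log (c : ℝ) →
            (c : ℝ) < C * ((rad a b c : ℕ) : ℝ) ^ (1 + ε)) :
    CompactBalanceTransfer :=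
  fun hH => stub_freySzpiroPaysComplement (h₁ hH) (h₂ (h₁ hH))

end Summit.ABC.ABC.Theorems.CompactBalanceTransfer.PowerDeep
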